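import Summits.ResolutionOfSingularities.ResolutionOfSingularities.Theorems.FrobeniusClosingPatchingRelPerfectDepthPhaseCLocalGamePatchReduction
import Summits.ResolutionOfSingularities.ResolutionOfSingularities.Theorems.FrobeniusClosingPatchingRelPerfectDepthPhaseCLocalGamePersistenceRows
import Literature.AlgebraicGeometry.Resolution.BlowupRestrictOpen
import HarnessLib

/-!
# Crux `PatchingRelPerfect` (stmt-ResolutionOfSingularities-16161), chain W5.2 — F7(β) (β-AX) X3 C-I (G2) engine:
# ONE GLOBAL MOVE SEEN FROM A PRESENTED PIECE (brick (b2) `PieceStep`)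

[OURS · L1 W5.2 · res-D-pv-046 ENGINE NOTE 4 2026-08-27T21:48:11Z CLAIM 1, res-L1-w52-lead-1 RECORD R13-4 (1) («GO on (b1)–(b4) as the
(H-snc) special case `endOrderReduction_of_sncLetters`»); line `Cruxes/PatchingRelPerfect/Lines/closed_point_slice.lean`.]  Replaces the role
of NO printed item; NOT a statement of the manuscript under review; fact-free; def-free; any locally Noetherian scheme.  AI-written; AI review
is weaker than expert review.

THE SETTING (Bierstone–Milman, proof of Thm. 8.5 / Lemma 8.7, chart by chart).  The (G2) engine blows up ONE global regular centre `Z` of the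
current top `T` per move (`τ : Bl_Z T → T`); every PRESENTED PIECE — an open `D ⊆ T` carrying the Route-K dictionary `MonomialCleanup.GameInv s
(Λ|_D) 𝒦 lab` (tree `…MonomialGameBridge`) for its own letter list `Λ` and rows `𝒦` with `K|_D = Σ𝒦` — sees the move in one of two ways:

* ON THE CENTRE (`Z|_D` = the stratum of the positions of `J`): `pieceStep_onCentre` — on the piece `τ⁻¹D` the dictionary holds for the MOVED
  state `PolyhedraGame.move s J e m` with letters `(Λ.map st_τ ++ [Z𝒪])|_{τ⁻¹D}` and rows `𝒦.map (transformExp · (τ|_D) · m)`, and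
  `(τᶜ(K, m))|_{τ⁻¹D} = Σ` of those rows (generic form `gameInv_move_and_transform_of_isBlowup`: ANY blow-up `π` of the `J`-stratum, weights
  `≥ m` on `J`; the restriction square by the Literature's `IsBlowup.restrict`, `controlledTransform_morphismRestrict`,
  `strictTransformIdeal_morphismRestrict`);
* OFF THE CENTRE (`Z|_D = 𝒪`): `pieceStep_offCentre` — `τ|_D` is an isomorphism, the dictionary for the SAME state transports along it
  (`gameInv_comap_of_isIso`), the new exceptional letter is `𝒪` on `τ⁻¹D` (a phantom the piece ignores), and `(τᶜ(K, m))|_{τ⁻¹D} = Σ` of the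
  pulled-back rows.

No piece is split (brick (b1) `ClopenCentre` chooses `Z` so that every piece is in one of the two cases).

## References (for the mathematics; nothing here is a statement of the manuscript under review)
* E. Bierstone, P. Milman, *Desingularization of toric and binomial varieties*, J. Algebraic Geom. 15 (2006), proof of Thm. 8.5, Lemma 8.7.
  [BierstoneMilman2006]
* J. Kollár, *Lectures on Resolution of Singularities* (2007), (3.111) Step 3. [Kollar2007]
* U. Görtz, T. Wedhorn, *Algebraic Geometry I*, 2nd ed. (2020), Prop. 13.91, (13.19). [GortzWedhorn2020]
-/

-- `Summit.<Summit>.<Sub>.Theorems` with `Sub = Summit` (single-conjunct summit, D-0017)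
set_option linter.dupNamespace false

noncomputable section

open CategoryTheory AlgebraicGeometry TopologicalSpace IsLocalRing
open Literature.AlgebraicGeometry.Resolution

namespace Summit.ResolutionOfSingularities.ResolutionOfSingularities.Theorems

namespace MonomialCleanup

open DepthTargets (monomialSum monomialSum_nil monomialSum_cons)
open PolyhedraGame (State move weight)

universe u

variable {X X' : Scheme.{u}}

/-! ## §1 One move along ANY blow-up of the stratum -/

open Classical in
/-- **The dictionary after one move along ANY blowing up of the `J`-stratum, and the transformed ideal.**  For a state `s` realised on `X` by
`GameInv s Es 𝒦 lab`, a set of live indices `J ⊆ s.B` on which every game vector has weight `≥ m`, a fresh index `e`, and ANY blow-up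
`π : X' → X` of the stratum `⨆{Es[k] : lab k ∈ J}`: the moved state `move s J e m` is realised on `X'` by the transformed letters and rows, and the
controlled transform of `Σ𝒦` with control `m` IS the monomial sum of the transformed rows (tree `gameInv_move_marked` and the stratum engine
`DepthMultiHost.controlledTransform_monomialSum_stratum`; the proof of p572454's recursion step, freed from `π = blowup.π`).
[cite: Kollar2007, (3.111) Step 3] [cite: BierstoneGrigorievMilmanWlodarczyk2011, Def. 3.1.3] -/
theorem gameInv_move_and_transform_of_isBlowup [IsLocallyNoetherian X] [IsLocallyNoetherian X'] {m : ℕ} {s : State}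
    {Es : List X.IdealSheafData} {𝒦 : List (List (X.IdealSheafData × ℕ))} {lab : ℕ → ℕ} (hinv : GameInv s Es 𝒦 lab)
    {J : Finset ℕ} (hJB : J ⊆ s.B) (hwt : ∀ α ∈ s.A, m ≤ weight J α) {e : ℕ} (he : e ∉ s.B) (π : X' ⟶ X)
    (hπ : IsBlowup π (((posOf Es lab J).image (nthSheaf Es)).sup id)) :
    GameInv (move s J e m)
        (Es.map (strictTransformIdeal π (((posOf Es lab J).image (nthSheaf Es)).sup id)) ++
          [(((posOf Es lab J).image (nthSheaf Es)).sup id).comap π])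
        (𝒦.map fun A => transformExp A π ((posOf Es lab J).image (nthSheaf Es)) m) (labMove Es lab e) ∧
      controlledTransform π (((posOf Es lab J).image (nthSheaf Es)).sup id) (monomialSum 𝒦) m =
        monomialSum (𝒦.map fun A => transformExp A π ((posOf Es lab J).image (nthSheaf Es)) m) := by
  set P := posOf Es lab J with hPdef
  set T := P.image (nthSheaf Es) with hTdef
  have hPlt : ∀ k ∈ P, k < Es.length := fun k hk => (mem_posOf_iff.mp hk).1
  have hT : ∀ K ∈ T, K ∈ Es := image_nthSheaf_subset hPlt
  refine ⟨gameInv_move_marked hinv hJB he hπ, ?_⟩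
  by_cases hCtop : T.sup id = ⊤
  · -- empty centre: both sides are the total transform
    rw [controlledTransform, hCtop, Scheme.IdealSheafData.comap_top, ← Scheme.IdealSheafData.one_eq_top, one_pow,
      Scheme.IdealSheafData.one_eq_top, colon_top, monomialSum_map_transformExp_eq_of_sup_eq_top hCtop,
      comap_monomialSum_eq_pow_mul hinv.snc hinv.bd hT hπ (m := 0) (fun A _ => Nat.zero_le _), pow_zero, one_mul]
  · -- non-empty centre: a common point of the positions of `J`, weights `≥ m`
    have hne : ((T.sup id).support : Set X).Nonempty := by
      by_contra h
      have hbot : (T.sup id).support = ⊥ := le_bot_iff.mp fun x hx => (h ⟨x, hx⟩).elim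
      exact hCtop ((Scheme.IdealSheafData.support_eq_bot_iff (I := T.sup id)).mp hbot)
    obtain ⟨x, hx⟩ := hne
    have hPx : ∀ k ∈ P, x ∈ (nthSheaf Es k).support := fun k hk =>
      (mem_support_finsetSup_iff T _).mp hx _ (Finset.mem_image_of_mem _ hk)
    refine DepthMultiHost.controlledTransform_monomialSum_stratum hinv.snc hinv.bd hT hπ fun A hA => ?_
    obtain ⟨α, hα, hagr⟩ := hinv.fwd A hA
    have hlenA : A.length = Es.length := hinv.length_eq hA
    have hPD : PointedDistinct (boundaryOf A) := (hinv.bd A hA).symm ▸ hinv.pd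
    have hPltA : ∀ k ∈ P, k < A.length := fun k hk => hlenA ▸ hPlt k hk
    have hPxA : ∀ k ∈ P, x ∈ (nthSheaf (boundaryOf A) k).support := fun k hk => by
      rw [hinv.bd A hA]; exact hPx k hk
    have hw := weightOf_image_nthSheaf_eq_sum hPD hPltA hPxA
    rw [hinv.bd A hA] at hw
    rw [hw, show ∑ k ∈ P, nthExp A k = ∑ k ∈ P, α (lab k) from
      Finset.sum_congr rfl fun k hk => (hagr k (hPlt k hk) ⟨x, hPx k hk⟩).symm, ← weight_eq_sum_posOf hinv hJB]
    exact hwt α hα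

/-! ## §2 The move seen from a piece ON the centre -/

open Classical in
/-- **ONE GLOBAL MOVE, SEEN FROM A PRESENTED PIECE ON THE CENTRE.**  Let `Z` be a centre on a locally Noetherian `T`, `τ : Bl_Z T → T`, and
`D ⊆ T` an open piece with letters `Λ|_D`, rows `𝒦`, dictionary `GameInv s (Λ|_D) 𝒦 lab` and `K|_D = Σ𝒦`; suppose `Z|_D` is the stratum of the
positions of `J ⊆ s.B` and every game vector has weight `≥ m` on `J`.  Then on the piece `τ⁻¹D` of `Bl_Z T` the moved state `move s J e m` is
realised by the GLOBAL transformed letters `(Λ.map st_τ ++ [Z𝒪])|_{τ⁻¹D}` and the rows transformed along `τ|_D`, and the global controlled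
transform restricts to their monomial sum. [cite: BierstoneMilman2006, proof of Thm. 8.5, Lemma 8.7] [cite: GortzWedhorn2020, Prop. 13.91] -/
theorem pieceStep_onCentre {T : Scheme.{u}} [IsLocallyNoetherian T] (Λ : List T.IdealSheafData) (K Z : T.IdealSheafData) (D : T.Opens)
    {m : ℕ} {s : State} {𝒦 : List (List ((D : Scheme.{u}).IdealSheafData × ℕ))} {lab : ℕ → ℕ}
    (hinv : GameInv s (Λ.map fun F => F.comap D.ι) 𝒦 lab) (hK : K.comap D.ι = monomialSum 𝒦)
    {J : Finset ℕ} (hJB : J ⊆ s.B) (hwt : ∀ α ∈ s.A, m ≤ weight J α) {e : ℕ} (he : e ∉ s.B)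
    (hZD : Z.comap D.ι = ((posOf (Λ.map fun F => F.comap D.ι) lab J).image (nthSheaf (Λ.map fun F => F.comap D.ι))).sup id) :
    GameInv (move s J e m)
        ((Λ.map (strictTransformIdeal (blowup.π Z) Z) ++ [Z.comap (blowup.π Z)]).map fun F => F.comap (blowup.π Z ⁻¹ᵁ D).ι)
        (𝒦.map fun A => transformExp A (blowup.π Z ∣_ D)
          ((posOf (Λ.map fun F => F.comap D.ι) lab J).image (nthSheaf (Λ.map fun F => F.comap D.ι))) m)
        (labMove (Λ.map fun F => F.comap D.ι) lab e) ∧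
      (controlledTransform (blowup.π Z) Z K m).comap (blowup.π Z ⁻¹ᵁ D).ι =
        monomialSum (𝒦.map fun A => transformExp A (blowup.π Z ∣_ D)
          ((posOf (Λ.map fun F => F.comap D.ι) lab J).image (nthSheaf (Λ.map fun F => F.comap D.ι))) m) := by
  haveI : IsLocallyNoetherian (blowup Z) := CentreSeq.isLocallyNoetherian_blowup Z
  set τ := blowup.π Z with hτ
  set Es := Λ.map fun F => F.comap D.ι with hEs
  set TJ := ((posOf Es lab J).image (nthSheaf Es)).sup id with hTJ
  have hπ : IsBlowup (τ ∣_ D) TJ := by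
    rw [← hZD]
    exact (blowup.isBlowup Z).restrict D
  obtain ⟨hginv, hkey⟩ := gameInv_move_and_transform_of_isBlowup hinv hJB hwt he (τ ∣_ D) hπ
  -- the global transformed letters restrict to the transformed letters of the piece
  have hL : ((Λ.map (strictTransformIdeal τ Z) ++ [Z.comap τ]).map fun F => F.comap (τ ⁻¹ᵁ D).ι) =
      Es.map (strictTransformIdeal (τ ∣_ D) TJ) ++ [TJ.comap (τ ∣_ D)] := by
    rw [← hZD]
    simp only [hEs, List.map_append, List.map_map, List.map_cons, List.map_nil, Function.comp_def,
      ← strictTransformIdeal_morphismRestrict, ← comap_comap_morphismRestrict]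
  refine ⟨hL ▸ hginv, ?_⟩
  rw [← controlledTransform_morphismRestrict, hZD, hK]
  exact hkey

/-! ## §3 Transporting the dictionary along an isomorphism -/

/-- Pull-back along an isomorphism is injective on ideal sheaves. [folklore] -/
theorem comap_injective_of_isIso (f : X' ⟶ X) [IsIso f] {I I' : X.IdealSheafData} (h : I.comap f = I'.comap f) : I = I' := by
  have h1 : ∀ K : X.IdealSheafData, (K.comap f).comap (inv f) = K := fun K => by
    rw [← Scheme.IdealSheafData.comap_comp, IsIso.inv_hom_id, Scheme.IdealSheafData.comap_id]
  rw [← h1 I, ← h1 I', h]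

/-- A point of the support of a pulled-back letter, pushed forward. [folklore] -/
theorem mem_support_of_mem_support_comap (f : X' ⟶ X) (I : X.IdealSheafData) {x' : X'} (hx' : x' ∈ (I.comap f).support) :
    f x' ∈ I.support := by
  have h : x' ∈ ((I.comap f).support : Set X') := hx'
  rw [Scheme.IdealSheafData.support_comap] at h
  exact h

/-- A point of the support of a letter, pulled back along an isomorphism. [folklore] -/
theorem mem_support_comap_inv (f : X' ⟶ X) [IsIso f] (I : X.IdealSheafData) {x : X} (hx : x ∈ I.support) :
    (inv f) x ∈ (I.comap f).support := by
  change (inv f) x ∈ ((I.comap f).support : Set X')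
  rw [Scheme.IdealSheafData.support_comap]
  change f ((inv f) x) ∈ (I.support : Set X)
  rw [← Scheme.Hom.comp_apply, IsIso.inv_hom_id]
  exact hx

/-- **The dictionary transports along an isomorphism** `f : X' ⟶ X`: same state, same labelling, letters and rows pulled back. [folklore] -/
theorem gameInv_comap_of_isIso [IsLocallyNoetherian X] (f : X' ⟶ X) [IsIso f] {s : State} {Es : List X.IdealSheafData}
    {𝒦 : List (List (X.IdealSheafData × ℕ))} {lab : ℕ → ℕ} (hinv : GameInv s Es 𝒦 lab) :
    GameInv s (Es.map fun F => F.comap f) (𝒦.map fun A => A.map fun p => (p.1.comap f, p.2)) lab := by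
  have hlen : (Es.map fun F => F.comap f).length = Es.length := List.length_map _
  -- pointedness and exponents at the positions are unchanged
  have hpt : ∀ k, k < Es.length → (Pointed (Es.map fun F => F.comap f) k ↔ Pointed Es k) := fun k hk => by
    constructor
    · rintro ⟨x', hx'⟩
      rw [nthSheaf_map Es _ hk] at hx'
      exact ⟨f x', mem_support_of_mem_support_comap f _ hx'⟩
    · rintro ⟨x, hx⟩
      exact ⟨(inv f) x, by rw [nthSheaf_map Es _ hk]; exact mem_support_comap_inv f _ hx⟩
  have hexp : ∀ (A : List (X.IdealSheafData × ℕ)) (k : ℕ), nthExp (A.map fun p => (p.1.comap f, p.2)) k = nthExp A k :=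
    fun A k => nthExp_map_fst A (fun I => I.comap f) k
  have hagree : ∀ A : List (X.IdealSheafData × ℕ), ∀ α : ℕ →₀ ℕ,
      Agree (Es.map fun F => F.comap f) lab (A.map fun p => (p.1.comap f, p.2)) α ↔ Agree Es lab A α := fun A α => by
    constructor
    · intro h k hk hp
      have h' := h k (hlen.symm ▸ hk) ((hpt k hk).mpr hp)
      rwa [hexp] at h'
    · intro h k hk hp
      rw [hlen] at hk
      rw [hexp]
      exact h k hk ((hpt k hk).mp hp)
  refine { snc := ?_, bd := ?_, pd := ?_, lab_inj := ?_, B_eq := ?_, str_B := hinv.str_B, supp := hinv.supp, str := ?_, fwd := ?_, bwd := ?_ }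
  · have h := hinv.snc.comap_of_isOpenImmersion f
    rwa [Scheme.IdealSheafData.comap_top] at h
  · intro A' hA'
    obtain ⟨A, hA, rfl⟩ := List.mem_map.mp hA'
    rw [DepthMultiHost.boundaryOf_map_comap, hinv.bd A hA]
  · intro k k' hk hk' hne x' hx hx' heq
    rw [hlen] at hk hk'
    rw [nthSheaf_map Es _ hk] at hx heq
    rw [nthSheaf_map Es _ hk'] at hx' heq
    exact hinv.pd k k' hk hk' hne (f x') (mem_support_of_mem_support_comap f _ hx) (mem_support_of_mem_support_comap f _ hx')
      (comap_injective_of_isIso f heq)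
  · intro k k' hk hk'
    rw [hlen] at hk hk'
    exact hinv.lab_inj k k' hk hk'
  · rw [hlen]; exact hinv.B_eq
  · intro S hS ⟨x', hx'⟩
    refine hinv.str S (fun k hk => hlen ▸ hS k hk) ⟨f x', fun k hk => ?_⟩
    have h := hx' k hk
    rw [nthSheaf_map Es _ (hlen ▸ hS k hk)] at h
    exact mem_support_of_mem_support_comap f _ h
  · intro A' hA'
    obtain ⟨A, hA, rfl⟩ := List.mem_map.mp hA'
    obtain ⟨α, hα, hagr⟩ := hinv.fwd A hA
    exact ⟨α, hα, (hagree A α).mpr hagr⟩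
  · intro α hα
    obtain ⟨A, hA, hagr⟩ := hinv.bwd α hα
    exact ⟨_, List.mem_map.mpr ⟨A, hA, rfl⟩, (hagree A α).mpr hagr⟩

/-! ## §4 The move seen from a piece OFF the centre -/

/-- **ONE GLOBAL MOVE, SEEN FROM A PRESENTED PIECE OFF THE CENTRE.**  With `Z`, `τ`, `D`, `Λ`, `𝒦` as in `pieceStep_onCentre` but `Z|_D = 𝒪`:
`τ|_D` is an isomorphism; on the piece `τ⁻¹D` the SAME state is realised by the strict transforms `(Λ.map st_τ)|_{τ⁻¹D}` (= the letters of `D` pulled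
back along `τ|_D`) and the pulled-back rows; the exceptional letter is `𝒪` on `τ⁻¹D`; and the global controlled transform restricts to the monomial
sum of the pulled-back rows. [cite: BierstoneMilman2006, proof of Thm. 8.5, Lemma 8.7] [cite: GortzWedhorn2020, Prop. 13.91 (3)] -/
theorem pieceStep_offCentre {T : Scheme.{u}} [IsLocallyNoetherian T] (Λ : List T.IdealSheafData) (K Z : T.IdealSheafData) (D : T.Opens)
    (m : ℕ) {s : State} {𝒦 : List (List ((D : Scheme.{u}).IdealSheafData × ℕ))} {lab : ℕ → ℕ}
    (hinv : GameInv s (Λ.map fun F => F.comap D.ι) 𝒦 lab) (hK : K.comap D.ι = monomialSum 𝒦) (hZD : Z.comap D.ι = ⊤) :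
    IsIso (blowup.π Z ∣_ D) ∧
      GameInv s ((Λ.map (strictTransformIdeal (blowup.π Z) Z)).map fun F => F.comap (blowup.π Z ⁻¹ᵁ D).ι)
        (𝒦.map fun A => A.map fun p => (p.1.comap (blowup.π Z ∣_ D), p.2)) lab ∧
      (Z.comap (blowup.π Z)).comap (blowup.π Z ⁻¹ᵁ D).ι = ⊤ ∧
      (controlledTransform (blowup.π Z) Z K m).comap (blowup.π Z ⁻¹ᵁ D).ι =
        monomialSum (𝒦.map fun A => A.map fun p => (p.1.comap (blowup.π Z ∣_ D), p.2)) := by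
  haveI : IsLocallyNoetherian (blowup Z) := CentreSeq.isLocallyNoetherian_blowup Z
  set τ := blowup.π Z with hτ
  have hπ : IsBlowup (τ ∣_ D) (Z.comap D.ι) := (blowup.isBlowup Z).restrict D
  haveI hiso : IsIso (τ ∣_ D) := hπ.isIso (hZD ▸ isEffectiveCartier_top)
  -- the strict transforms restrict to the pulled-back letters
  have hL : ((Λ.map (strictTransformIdeal τ Z)).map fun F => F.comap (τ ⁻¹ᵁ D).ι) =
      (Λ.map fun F => F.comap D.ι).map fun F => F.comap (τ ∣_ D) := by
    simp only [List.map_map, Function.comp_def, ← strictTransformIdeal_morphismRestrict, hZD,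
      X3LemmaM.strictTransformIdeal_eq_comap_of_eq_top (τ ∣_ D) rfl]
  refine ⟨hiso, hL ▸ gameInv_comap_of_isIso (τ ∣_ D) hinv, ?_, ?_⟩
  · rw [← comap_comap_morphismRestrict, hZD, Scheme.IdealSheafData.comap_top]
  · rw [← controlledTransform_morphismRestrict, hZD, X3LemmaM.controlledTransform_eq_comap_of_eq_top (τ ∣_ D) rfl, hK,
      DepthMultiHost.comap_monomialSum_map]

end MonomialCleanup

end Summit.ResolutionOfSingularities.ResolutionOfSingularities.Theorems

end
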